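import Literature.NumberTheory.EllipticCurves.LangTorsorFrobenius
import Literature.FieldTheory.ArtinSchreier.Extension
import Literature.NumberTheory.DiophantineGeometry.FunctionFieldSchmidtDegreeOneExtensionProofs
import HarnessLib

/-!
# The Lang torsor of an elliptic curve over a finite field, III: the Lang cover as an extension of
`k(W)` and the Artin–Schreier layer on top of it (Kohel–Shparlinski §2)

Topic `NumberTheory/EllipticCurves`. Third file of the arithmetic half of the discharge of the named
fact `Literature.NumberTheory.EllipticCurves.KohelShparlinski.CoordinateCharSumBound`. The first two
files (`LangTorsor`, `LangTorsorFrobenius`) construct the translations `τ_T` of `k(W)` (`T ∈ W(k)`),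
the map `λ = (φ - 1)^* : k(W) → k(W)` with `λ(k(W)) = k(W)^{τ(W(k))}`, `[k(W) : λ k(W)] = #W(k)`,
and show `α λ x ∉ ℘(k(W))` (`p ≠ 2`), `α λ y ∉ ℘(k(W))` (`p ≠ 3`). Here:

* `LangCover W` — the field `k(W)` regarded as a `k(W)`-algebra THROUGH `λ` (a type synonym carrying
  `Algebra k(W) (LangCover W) := λ`; as a `k`-algebra, hence for places, genus and point counts, it is
  literally `k(W)`): `LangCover.finrank_eq : [LangCover W : k(W)] = #W(k)`, the translations as
  `k(W)`-automorphisms `LangCover.transl T`, **`LangCover.isGalois`** and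
  **`LangCover.translMulEquiv : W(k) ≃* Gal(LangCover W / k(W))`** (the Lang torsor
  `φ - 1 : E → E` is Galois with group `E(k)`; Silverman *AEC* III.4.10(b), V.§1);
* `LangASCover W p g₁ := ASExt (LangCover W) p (λ g₁)` — the Artin–Schreier layer
  `Z^p - Z = λ g₁` on top (a field under `[Fact (∀ s, s^p - s ≠ λ g₁)]`, supplied for `g₁ = α x`,
  `g₁ = α y` by `pow_sub_self_ne_smul_lam_gT/gS`), the tower `k(W) ⊆ LangCover W ⊆ L`,
  `LangASCover.finrank_eq : [L : k(W)] = p · #W(k)`, the automorphisms `σ_{T,i}` (`τ_T` below,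
  `ϑ ↦ ϑ + i` on the generator; `ArtinSchreier.liftEquiv`), **`LangASCover.isGalois`** and
  **`LangASCover.galEquiv : W(k) × ℤ/p ≃* Gal(L / k(W))`** with the component homomorphisms
  `langComp`, `asComp`, the action lemmas `apply_algebraMap` (`θ|_{LangCover} = τ_{langComp θ}`),
  `apply_gen` (`θ ϑ = ϑ + asComp θ`), `restrictNormal_eq`, and `isAlgFunctionField` (`L/k` is a
  function field). This is the covering whose `L`-functions carry the sums
  `Σ ω(P) ψ(f(P))` of [KohelShparlinski2000, §2].

Everything is proved; no named facts; definitions are genuine.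

## References

* D. R. Kohel, I. E. Shparlinski, *On exponential sums and group generators for elliptic curves
  over finite fields*, ANTS-IV, LNCS 1838 (2000), 395–404, §2. [KohelShparlinski2000]
* J. H. Silverman, *The Arithmetic of Elliptic Curves*, 2nd ed., GTM 106, III.4.10(b), V.§1. [SilvermanAEC2009]
* H. Stichtenoth, *Algebraic Function Fields and Codes*, 2nd ed., GTM 254, Prop. 3.7.8. [Stichtenoth2009]
-/

noncomputable section

open Polynomial WeierstrassCurve WeierstrassCurve.Affine

universe u

namespace Literature.NumberTheory.EllipticCurves.LangTorsor

open Literature.FieldTheory.ArtinSchreier Literature.NumberTheory.DiophantineGeometry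
open scoped IntermediateField

variable {F : Type u} [Field F] (W : WeierstrassCurve F)

/-! ### The Lang cover `k(W) ⊇ λ(k(W))` as an algebra `k(W) → LangCover W` -/

section Cover

/-- **The Lang cover.** The function field `k(W)` regarded as an extension of `k(W)` through
`λ = (φ - 1)^* : k(W) → k(W)`: as a `k`-algebra it IS `k(W)` (same field, same constants, same
places), and it carries the extra structure `Algebra k(W) (LangCover W)` given by `λ`. This realises the
Galois covering `φ - 1 : E → E` with group `E(k)` on function fields with base `k(W)` itself.
[cite: SilvermanAEC2009, III.4.10 and V.§1] -/
def LangCover : Type u := W.toAffine.FunctionField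

namespace LangCover

/-- `LangCover W` is the field `k(W)`. [folklore] -/
instance instField : Field (LangCover W) := inferInstanceAs (Field W.toAffine.FunctionField)

/-- `LangCover W` is inhabited. [folklore] -/
instance instInhabited : Inhabited (LangCover W) := ⟨0⟩

/-- The `k`-algebra structure of `LangCover W` is that of `k(W)`. [folklore] -/
instance instAlgebraBase : Algebra F (LangCover W) :=
  inferInstanceAs (Algebra F W.toAffine.FunctionField)

variable [W.IsElliptic]

/-- `LangCover W / k` is an algebraic function field of one variable (it is `k(W)`). [folklore] -/
instance instIsAlgFunctionField : IsAlgFunctionField F (LangCover W) :=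
  inferInstanceAs (IsAlgFunctionField F W.toAffine.FunctionField)

/-- `k` is the full constant field of `LangCover W` (it is `k(W)`). [folklore] -/
instance instIsIntegrallyClosedIn : IsIntegrallyClosedIn F (LangCover W) :=
  inferInstanceAs (IsIntegrallyClosedIn F W.toAffine.FunctionField)

omit [W.IsElliptic] in
/-- The function field `LangCover W` has the characteristic of `k`. [folklore] -/
instance instCharP (p : ℕ) [CharP F p] : CharP (LangCover W) p :=
  charP_of_injective_algebraMap (algebraMap F (LangCover W)).injective p

/-- The identification of `k`-algebras `k(W) ≃ LangCover W` (the identity map). [folklore] -/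
def ofFun : W.toAffine.FunctionField ≃ₐ[F] LangCover W := AlgEquiv.refl

variable [Fintype F] [DecidableEq F]

/-- **The algebra structure `λ : k(W) → LangCover W`.** [cite: SilvermanAEC2009, V.§1] -/
instance instAlgebra : Algebra W.toAffine.FunctionField (LangCover W) :=
  ((ofFun W : W.toAffine.FunctionField →+* LangCover W).comp (lam W : _ →+* _)).toAlgebra

/-- `algebraMap k(W) (LangCover W) = λ`. [folklore] -/
theorem algebraMap_apply (h : W.toAffine.FunctionField) :
    algebraMap W.toAffine.FunctionField (LangCover W) h = ofFun W (lam W h) :=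
  rfl

/-- `k → k(W) → LangCover W` is a scalar tower (`λ` is a `k`-algebra map). [folklore] -/
instance instIsScalarTower : IsScalarTower F W.toAffine.FunctionField (LangCover W) :=
  IsScalarTower.of_algebraMap_eq fun c => by
    rw [algebraMap_apply, AlgHom.commutes]; rfl

/-- `λ` as a ring isomorphism onto its image `λ(k(W)) ⊆ k(W)`. [folklore] -/
def lamEquivFieldRange : W.toAffine.FunctionField ≃+* (lam W).fieldRange :=
  RingEquiv.ofBijective
    ((lam W : W.toAffine.FunctionField →+* W.toAffine.FunctionField).codRestrict (lam W).fieldRange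
      fun h => (lam W).mem_fieldRange.2 ⟨h, rfl⟩)
    ⟨fun a b h => lam_injective (Subtype.ext_iff.1 h), fun z => by
      obtain ⟨h, hh⟩ := (lam W).mem_fieldRange.1 z.2
      exact ⟨h, Subtype.ext hh⟩⟩

/-- **`[LangCover W : k(W)] = #W(k)`** (`= [k(W) : λ(k(W))]`, `finrank_fieldRange_lam`).
[cite: SilvermanAEC2009, V.§1] -/
theorem finrank_eq :
    Module.finrank W.toAffine.FunctionField (LangCover W) = Nat.card W.toAffine.Point := by
  rw [← finrank_fieldRange_lam (W := W)]
  exact Algebra.finrank_eq_of_equiv_equiv (lamEquivFieldRange W) (ofFun W).symm.toRingEquiv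
    (RingHom.ext fun h => rfl)

/-- `LangCover W` is finite over `k(W)`. [cite: SilvermanAEC2009, V.§1] -/
instance finiteDimensional : FiniteDimensional W.toAffine.FunctionField (LangCover W) := by
  haveI : Finite W.toAffine.Point := finite_point
  exact Module.finite_of_finrank_pos (by rw [finrank_eq]; exact Nat.card_pos)

/-- **The translation `τ_T` as a `k(W)`-algebra automorphism of the Lang cover** (it fixes
`λ(k(W))` pointwise: `translEquiv_lam`). [cite: SilvermanAEC2009, III.4.10(b)] -/
def transl (T : W.toAffine.Point) : LangCover W ≃ₐ[W.toAffine.FunctionField] LangCover W :=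
  { (translEquiv T : W.toAffine.FunctionField ≃+* W.toAffine.FunctionField) with
    commutes' := fun h => translEquiv_lam T h }

/-- `LangCover.transl T` is `translEquiv T` on elements. [folklore] -/
theorem transl_apply (T : W.toAffine.Point) (z : LangCover W) :
    transl W T z = ofFun W (translEquiv T ((ofFun W).symm z)) :=
  rfl

/-- `τ_{T+T'} = τ_T τ_{T'}` on the Lang cover. [cite: SilvermanAEC2009, III.4.10(b)] -/
theorem transl_add (T T' : W.toAffine.Point) : transl W (T + T') = transl W T * transl W T' := by
  apply AlgEquiv.ext; intro z
  rw [AlgEquiv.mul_apply, transl_apply, transl_apply, transl_apply, translEquiv_add]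
  rfl

/-- `τ_O = 1` on the Lang cover. [folklore] -/
theorem transl_zero : transl W (0 : W.toAffine.Point) = 1 := by
  apply AlgEquiv.ext; intro z
  rw [transl_apply, translEquiv_zero]
  rfl

/-- `T ↦ τ_T` is injective. [folklore] -/
theorem transl_injective : Function.Injective (transl W) := by
  intro T T' h
  apply translEquiv_injective (W := W)
  apply AlgEquiv.ext; intro z
  have := congrArg (fun e => e (ofFun W z)) h
  simpa [transl_apply] using this

/-- **The translation group `W(k) → Gal(LangCover W / k(W))`.** [cite: SilvermanAEC2009, III.4.10(b)] -/
def translAutHom : Multiplicative W.toAffine.Point →* (LangCover W ≃ₐ[W.toAffine.FunctionField] LangCover W) where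
  toFun T := transl W T.toAdd
  map_one' := transl_zero W
  map_mul' T T' := transl_add W T.toAdd T'.toAdd

/-- `translAutHom` on `ofAdd T` is `transl T`. [folklore] -/
@[simp]
theorem translAutHom_ofAdd (T : W.toAffine.Point) : translAutHom W (Multiplicative.ofAdd T) = transl W T := rfl

/-- `translAutHom` is injective. [folklore] -/
theorem translAutHom_injective : Function.Injective (translAutHom W) := fun _ _ h =>
  Multiplicative.toAdd.injective (transl_injective W h)

/-- **`#Gal(LangCover W / k(W)) = #W(k)`**: at least `#W(k)` translations, at most the degree.
[cite: SilvermanAEC2009, III.4.10(b) and V.§1] -/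
theorem natCard_algEquiv :
    Nat.card (LangCover W ≃ₐ[W.toAffine.FunctionField] LangCover W) = Nat.card W.toAffine.Point := by
  haveI : Finite W.toAffine.Point := finite_point
  apply le_antisymm
  · rw [← finrank_eq W, Nat.card_eq_fintype_card]
    exact AlgEquiv.card_le
  · exact Nat.card_le_card_of_injective _ (translAutHom_injective W)

/-- **The Lang cover is Galois over `k(W)`** with group the translations. [cite: SilvermanAEC2009, III.4.10(b) and V.§1] -/
instance isGalois : IsGalois W.toAffine.FunctionField (LangCover W) :=
  IsGalois.of_card_aut_eq_finrank _ _ ((natCard_algEquiv W).trans (finrank_eq W).symm)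

/-- `T ↦ τ_T` is a bijection onto `Gal(LangCover W / k(W))`. [cite: SilvermanAEC2009, III.4.10(b)] -/
theorem translAutHom_bijective : Function.Bijective (translAutHom W) := by
  haveI : Finite W.toAffine.Point := finite_point
  refine (Nat.bijective_iff_injective_and_card _).2 ⟨translAutHom_injective W, ?_⟩
  rw [natCard_algEquiv]; rfl

/-- **`Gal(LangCover W / k(W)) ≅ W(k)`.** [cite: SilvermanAEC2009, III.4.10(b) and V.§1] -/
def translMulEquiv : Multiplicative W.toAffine.Point ≃* (LangCover W ≃ₐ[W.toAffine.FunctionField] LangCover W) :=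
  MulEquiv.ofBijective (translAutHom W) (translAutHom_bijective W)

/-- Unfolding `translMulEquiv`. [folklore] -/
@[simp]
theorem translMulEquiv_apply (T : Multiplicative W.toAffine.Point) : translMulEquiv W T = translAutHom W T := rfl

end LangCover

end Cover

/-! ### The Artin–Schreier layer on top of the Lang cover and its Galois group `W(k) × ℤ/p` -/

section ASLayer

variable [W.IsElliptic] [Fintype F] [DecidableEq F]
variable (p : ℕ) [Fact p.Prime] [CharP F p] (g₁ : W.toAffine.FunctionField)

/-- **The Lang–Artin–Schreier cover** `L = (LangCover W)[Z]/(Z^p - Z - λ g₁)` of `k(W)`, for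
`g₁ ∈ k(W)` with `λ g₁ ∉ ℘` (e.g. `g₁ = α x`, `p ≠ 2`, or `g₁ = α y`, `p ≠ 3`:
`pow_sub_self_ne_smul_lam_gT/gS`). Its Galois group over `k(W)` is `W(k) × ℤ/p`.
[cite: KohelShparlinski2000, §2] [cite: Stichtenoth2009, Prop. 3.7.8] -/
abbrev LangASCover : Type u := ASExt (LangCover W) p (algebraMap W.toAffine.FunctionField (LangCover W) g₁)

variable [Fact (∀ s : LangCover W, s ^ p - s ≠ algebraMap W.toAffine.FunctionField (LangCover W) g₁)]

namespace LangASCover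

/-- The generator `ϑ` (class of `Z`) of the Artin–Schreier layer. [folklore] -/
abbrev gen : LangASCover W p g₁ :=
  AdjoinRoot.root (asPoly (LangCover W) p (algebraMap W.toAffine.FunctionField (LangCover W) g₁))

/-- `k(W) → LangCover W → L` is a scalar tower. [folklore] -/
instance isScalarTower_cover :
    IsScalarTower W.toAffine.FunctionField (LangCover W) (LangASCover W p g₁) :=
  inferInstance

/-- `L` is finite over `k(W)`. [folklore] -/
instance finiteDimensional : FiniteDimensional W.toAffine.FunctionField (LangASCover W p g₁) :=
  FiniteDimensional.trans W.toAffine.FunctionField (LangCover W) (LangASCover W p g₁)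

/-- **`[L : k(W)] = p · #W(k)`.** [cite: KohelShparlinski2000, §2] -/
theorem finrank_eq :
    Module.finrank W.toAffine.FunctionField (LangASCover W p g₁) = Nat.card W.toAffine.Point * p := by
  rw [← Module.finrank_mul_finrank W.toAffine.FunctionField (LangCover W) (LangASCover W p g₁),
    LangCover.finrank_eq, Literature.FieldTheory.ArtinSchreier.finrank_eq]

/-- `L/k` is an algebraic function field of one variable. [folklore] -/
instance isAlgFunctionField : IsAlgFunctionField F (LangASCover W p g₁) :=
  AlgFunctionField.isAlgFunctionField_of_finiteDimensional (K := F) (F := LangCover W) (F' := LangASCover W p g₁)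

/-- The automorphism `σ_{T,i}`: `τ_T` on the Lang cover, `ϑ ↦ ϑ + i` on the generator.
[cite: KohelShparlinski2000, §2] -/
def sigma (T : W.toAffine.Point) (i : ZMod p) :
    LangASCover W p g₁ ≃ₐ[W.toAffine.FunctionField] LangASCover W p g₁ :=
  liftEquiv (K₀ := W.toAffine.FunctionField) (LangCover.transl W T)
    ((LangCover.transl W T).commutes g₁) i.val

/-- `σ_{T,i}` acts on the Lang cover as `τ_T`. [cite: KohelShparlinski2000, §2] -/
theorem sigma_algebraMap (T : W.toAffine.Point) (i : ZMod p) (h : LangCover W) :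
    sigma W p g₁ T i (algebraMap (LangCover W) _ h) = algebraMap (LangCover W) _ (LangCover.transl W T h) :=
  liftEquiv_algebraMap _ _ _ h

/-- `σ_{T,i} ϑ = ϑ + i`. [cite: KohelShparlinski2000, §2] -/
theorem sigma_gen (T : W.toAffine.Point) (i : ZMod p) :
    sigma W p g₁ T i (gen W p g₁) = gen W p g₁ + (i.val : LangASCover W p g₁) :=
  liftEquiv_root _ _ _

omit [Fact (∀ s : LangCover W, s ^ p - s ≠ algebraMap W.toAffine.FunctionField (LangCover W) g₁)] in
/-- `((i + j).val : L) = i.val + j.val` in characteristic `p`. [folklore] -/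
theorem natCast_val_add (i j : ZMod p) {R : Type*} [Ring R] [CharP R p] :
    ((i + j).val : R) = (i.val : R) + (j.val : R) := by
  haveI : NeZero p := ⟨(Fact.out : p.Prime).ne_zero⟩
  rw [ZMod.val_add, ← Nat.cast_add, CharP.natCast_eq_natCast R p]
  exact Nat.mod_modEq _ _

/-- `σ_{T,i} σ_{T',i'} = σ_{T+T',i+i'}`. [cite: KohelShparlinski2000, §2] -/
theorem sigma_mul (T T' : W.toAffine.Point) (i i' : ZMod p) :
    sigma W p g₁ T i * sigma W p g₁ T' i' = sigma W p g₁ (T + T') (i + i') := by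
  haveI : CharP (LangASCover W p g₁) p :=
    charP_of_injective_algebraMap (algebraMap (LangCover W) _).injective p
  have key : ((sigma W p g₁ T i : LangASCover W p g₁ →+* LangASCover W p g₁).comp
      (sigma W p g₁ T' i' : LangASCover W p g₁ →+* LangASCover W p g₁)) =
        (sigma W p g₁ (T + T') (i + i') : LangASCover W p g₁ →+* LangASCover W p g₁) := by
    refine Literature.FieldTheory.ArtinSchreier.ringHom_ext (fun h => ?_) ?_
    · change sigma W p g₁ T i (sigma W p g₁ T' i' (algebraMap (LangCover W) _ h)) =
        sigma W p g₁ (T + T') (i + i') (algebraMap (LangCover W) _ h)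
      rw [sigma_algebraMap, sigma_algebraMap, sigma_algebraMap, LangCover.transl_add, AlgEquiv.mul_apply]
    · change sigma W p g₁ T i (sigma W p g₁ T' i' (gen W p g₁)) = sigma W p g₁ (T + T') (i + i') (gen W p g₁)
      rw [sigma_gen, map_add, map_natCast, sigma_gen, sigma_gen, natCast_val_add, add_assoc]
  apply AlgEquiv.ext; intro z
  exact RingHom.congr_fun key z

/-- `σ_{O,0} = 1`. [folklore] -/
theorem sigma_zero : sigma W p g₁ 0 0 = 1 := by
  have h := sigma_mul W p g₁ 0 0 0 0
  rw [add_zero, add_zero] at h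
  exact mul_left_cancel (h.trans (mul_one _).symm)

/-- **The Galois group map** `W(k) × ℤ/p → Gal(L/k(W))`, `(T, i) ↦ σ_{T,i}`. [cite: KohelShparlinski2000, §2] -/
def galHom : Multiplicative W.toAffine.Point × Multiplicative (ZMod p) →*
    (LangASCover W p g₁ ≃ₐ[W.toAffine.FunctionField] LangASCover W p g₁) where
  toFun x := sigma W p g₁ x.1.toAdd x.2.toAdd
  map_one' := sigma_zero W p g₁
  map_mul' x y := (sigma_mul W p g₁ x.1.toAdd y.1.toAdd x.2.toAdd y.2.toAdd).symm

/-- Unfolding `galHom`. [folklore] -/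
theorem galHom_apply (x : Multiplicative W.toAffine.Point × Multiplicative (ZMod p)) :
    galHom W p g₁ x = sigma W p g₁ x.1.toAdd x.2.toAdd := rfl

/-- `(T, i) ↦ σ_{T,i}` is injective (`σ` determines `τ_T` on the Lang cover and `i mod p` on `ϑ`).
[cite: KohelShparlinski2000, §2] -/
theorem galHom_injective : Function.Injective (galHom W p g₁) := by
  intro x y h
  rw [galHom_apply, galHom_apply] at h
  obtain ⟨h1, h2⟩ := eq_and_modEq_of_liftEquiv_eq h
  refine Prod.ext (Multiplicative.toAdd.injective (LangCover.transl_injective W h1))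
    (Multiplicative.toAdd.injective ?_)
  have := (ZMod.natCast_eq_natCast_iff' x.2.toAdd.val y.2.toAdd.val p).2 h2
  rwa [ZMod.natCast_zmod_val, ZMod.natCast_zmod_val] at this

/-- **`#Gal(L/k(W)) = p · #W(k) = [L : k(W)]`.** [cite: KohelShparlinski2000, §2] -/
theorem natCard_algEquiv :
    Nat.card (LangASCover W p g₁ ≃ₐ[W.toAffine.FunctionField] LangASCover W p g₁) =
      Nat.card W.toAffine.Point * p := by
  haveI : Finite W.toAffine.Point := finite_point
  apply le_antisymm
  · rw [← finrank_eq W p g₁, Nat.card_eq_fintype_card]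
    exact AlgEquiv.card_le
  · have h := Nat.card_le_card_of_injective _ (galHom_injective W p g₁)
    rwa [Nat.card_prod, Nat.card_eq_fintype_card (α := Multiplicative (ZMod p)),
      Fintype.card_multiplicative, ZMod.card] at h

/-- **`L / k(W)` is Galois.** [cite: KohelShparlinski2000, §2] -/
instance isGalois : IsGalois W.toAffine.FunctionField (LangASCover W p g₁) :=
  IsGalois.of_card_aut_eq_finrank _ _ ((natCard_algEquiv W p g₁).trans (finrank_eq W p g₁).symm)

/-- `(T, i) ↦ σ_{T,i}` is a bijection onto `Gal(L/k(W))`. [cite: KohelShparlinski2000, §2] -/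
theorem galHom_bijective : Function.Bijective (galHom W p g₁) := by
  haveI : Finite W.toAffine.Point := finite_point
  refine (Nat.bijective_iff_injective_and_card _).2 ⟨galHom_injective W p g₁, ?_⟩
  rw [natCard_algEquiv, Nat.card_prod, Nat.card_eq_fintype_card (α := Multiplicative (ZMod p)),
    Fintype.card_multiplicative, ZMod.card]
  rfl

/-- **`Gal(L/k(W)) ≅ W(k) × ℤ/p`.** [cite: KohelShparlinski2000, §2] -/
def galEquiv : Multiplicative W.toAffine.Point × Multiplicative (ZMod p) ≃*
    (LangASCover W p g₁ ≃ₐ[W.toAffine.FunctionField] LangASCover W p g₁) :=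
  MulEquiv.ofBijective (galHom W p g₁) (galHom_bijective W p g₁)

/-- Unfolding `galEquiv`. [folklore] -/
@[simp]
theorem galEquiv_apply (x : Multiplicative W.toAffine.Point × Multiplicative (ZMod p)) :
    galEquiv W p g₁ x = sigma W p g₁ x.1.toAdd x.2.toAdd := rfl

/-- **The Lang component** `Gal(L/k(W)) → W(k)` of an automorphism. [cite: KohelShparlinski2000, §2] -/
def langComp : (LangASCover W p g₁ ≃ₐ[W.toAffine.FunctionField] LangASCover W p g₁) →*
    Multiplicative W.toAffine.Point :=
  (MonoidHom.fst _ _).comp (galEquiv W p g₁).symm.toMonoidHom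

/-- **The Artin–Schreier component** `Gal(L/k(W)) → ℤ/p` of an automorphism. [cite: KohelShparlinski2000, §2] -/
def asComp : (LangASCover W p g₁ ≃ₐ[W.toAffine.FunctionField] LangASCover W p g₁) →*
    Multiplicative (ZMod p) :=
  (MonoidHom.snd _ _).comp (galEquiv W p g₁).symm.toMonoidHom

/-- Every automorphism is `σ_{T,i}` with `T` its Lang component and `i` its AS component. [folklore] -/
theorem eq_sigma (θ : LangASCover W p g₁ ≃ₐ[W.toAffine.FunctionField] LangASCover W p g₁) :
    θ = sigma W p g₁ (langComp W p g₁ θ).toAdd (asComp W p g₁ θ).toAdd := by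
  conv_lhs => rw [← (galEquiv W p g₁).apply_symm_apply θ]
  rfl

/-- The Lang component of `σ_{T,i}` is `T`. [folklore] -/
@[simp] theorem langComp_sigma (T : W.toAffine.Point) (i : ZMod p) :
    langComp W p g₁ (sigma W p g₁ T i) = Multiplicative.ofAdd T := by
  have h : (galEquiv W p g₁).symm (sigma W p g₁ T i) = (Multiplicative.ofAdd T, Multiplicative.ofAdd i) :=
    (galEquiv W p g₁).symm_apply_eq.2 rfl
  simp [langComp, h]

/-- The AS component of `σ_{T,i}` is `i`. [folklore] -/
@[simp] theorem asComp_sigma (T : W.toAffine.Point) (i : ZMod p) :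
    asComp W p g₁ (sigma W p g₁ T i) = Multiplicative.ofAdd i := by
  have h : (galEquiv W p g₁).symm (sigma W p g₁ T i) = (Multiplicative.ofAdd T, Multiplicative.ofAdd i) :=
    (galEquiv W p g₁).symm_apply_eq.2 rfl
  simp [asComp, h]

/-- **An automorphism acts on the Lang cover through its Lang component**:
`θ|_{LangCover} = τ_{langComp θ}`. [cite: KohelShparlinski2000, §2] -/
theorem apply_algebraMap (θ : LangASCover W p g₁ ≃ₐ[W.toAffine.FunctionField] LangASCover W p g₁)
    (h : LangCover W) :
    θ (algebraMap (LangCover W) _ h) =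
      algebraMap (LangCover W) _ (LangCover.transl W (langComp W p g₁ θ).toAdd h) := by
  conv_lhs => rw [eq_sigma W p g₁ θ]
  exact sigma_algebraMap W p g₁ _ _ h

/-- **An automorphism acts on the generator through its AS component**: `θ ϑ = ϑ + asComp θ`.
[cite: KohelShparlinski2000, §2] -/
theorem apply_gen (θ : LangASCover W p g₁ ≃ₐ[W.toAffine.FunctionField] LangASCover W p g₁) :
    θ (gen W p g₁) = gen W p g₁ + ((asComp W p g₁ θ).toAdd.val : LangASCover W p g₁) := by
  conv_lhs => rw [eq_sigma W p g₁ θ]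
  exact sigma_gen W p g₁ _ _

/-- The AS component vanishes exactly on the automorphisms fixing `ϑ`. [folklore] -/
theorem asComp_eq_one_iff (θ : LangASCover W p g₁ ≃ₐ[W.toAffine.FunctionField] LangASCover W p g₁) :
    asComp W p g₁ θ = 1 ↔ θ (gen W p g₁) = gen W p g₁ := by
  haveI : CharP (LangASCover W p g₁) p :=
    charP_of_injective_algebraMap (algebraMap (LangCover W) _).injective p
  rw [apply_gen, add_eq_left]
  constructor
  · intro h; rw [h]; simp
  · intro h
    have h' : ((asComp W p g₁ θ).toAdd.val : LangASCover W p g₁) = ((0 : ℕ) : LangASCover W p g₁) := by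
      rw [h, Nat.cast_zero]
    haveI : NeZero p := ⟨(Fact.out : p.Prime).ne_zero⟩
    have hmod := (CharP.natCast_eq_natCast (LangASCover W p g₁) p).1 h'
    rw [Nat.ModEq, Nat.zero_mod, Nat.mod_eq_of_lt (ZMod.val_lt _)] at hmod
    exact Multiplicative.toAdd.injective ((ZMod.val_eq_zero _).1 hmod)

/-- The Lang component vanishes exactly on `Gal(L / LangCover W)` (automorphisms fixing the Lang
cover pointwise). [folklore] -/
theorem langComp_eq_one_iff (θ : LangASCover W p g₁ ≃ₐ[W.toAffine.FunctionField] LangASCover W p g₁) :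
    langComp W p g₁ θ = 1 ↔ ∀ h : LangCover W, θ (algebraMap (LangCover W) _ h) = algebraMap (LangCover W) _ h := by
  constructor
  · intro h1 h
    rw [apply_algebraMap, h1]
    change algebraMap (LangCover W) _ (LangCover.transl W 0 h) = _
    rw [LangCover.transl_zero]; rfl
  · intro hfix
    have key : LangCover.transl W (langComp W p g₁ θ).toAdd = 1 := by
      apply AlgEquiv.ext; intro h
      apply (algebraMap (LangCover W) (LangASCover W p g₁)).injective
      rw [← apply_algebraMap, hfix]; rfl
    rw [← LangCover.transl_zero W] at key
    exact Multiplicative.toAdd.injective (LangCover.transl_injective W key)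

/-- **Restriction to the Lang cover**: `θ|_{LangCover W} = τ_{langComp θ}` as automorphisms.
[cite: KohelShparlinski2000, §2] -/
theorem restrictNormal_eq (θ : LangASCover W p g₁ ≃ₐ[W.toAffine.FunctionField] LangASCover W p g₁) :
    θ.restrictNormal (LangCover W) = LangCover.transl W (langComp W p g₁ θ).toAdd := by
  apply AlgEquiv.ext; intro h
  apply (algebraMap (LangCover W) (LangASCover W p g₁)).injective
  rw [AlgEquiv.restrictNormal_commutes, apply_algebraMap]

end LangASCover

end ASLayer

end Literature.NumberTheory.EllipticCurves.LangTorsor
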